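import Summits.HodgeConjecture.HodgeConjecture.Theorems.VHCAbelianSchemesRoadRegimeSplit
import Literature.AlgebraicGeometry.HodgeTheory.DivisorClassesHardLefschetz
import Literature.AlgebraicGeometry.HodgeTheory.LefschetzOneOneHolds
import Literature.AlgebraicGeometry.HodgeTheory.AlgebraicClassesCupDivisorHolds
import HarnessLib

/-!
# Road b02 (`VHCAbelianSchemesRoad`, D-0059) — DEGREE CONFINEMENT of K-SR♭∃: the exceptional regime is VOID off `2 ≤ p ≤ n − 2`

research route conditional on HC_CM; not a corollary; Q11.4-sentence-2 already refuted in dim ≥ 3.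

THEOREMS ONLY (no definition, no named fact, no sorry; `HC_CM` occurs nowhere; K-SR♭∃ / its exceptional regime / K-C / the doors /
`AbelianSchemeVHC` / HC_AV are NOT claimed). Over the GRADED regime vocabulary `LefAtExceptionalRegimeAt 𝒪 n p`,
`AdmissibleRepresentativesLefAtDeg 𝒪 n p` (`VHCAbelianSchemesRoadRegimeDefs` §2, p441761: the bodies of `LefAtExceptionalRegime 𝒪` /
`AdmissibleRepresentativesLefAt 𝒪` with the relative dimension `n` and the codimension `p` fixed).

## The point

The crux of the road, K-SR♭∃ (`AdmissibleRepresentativesLefAt 𝒪`, item 19274 over the twisted door, aside 19779 over the sheaf door),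
quantifies over ALL one-parameter abelian schemes of ALL relative dimensions `n` and ALL codimensions `p`; after stub 1 (regime 1, the
null datum, p434003 / p434017) its content is the EXCEPTIONAL regime «`W` is not an algebraic Lefschetz class on every fibre»
(`twAt_iff_exceptionalRegimeTw`, p436772). This file confines that regime BY DEGREE, for EVERY door `𝒪` and with NO input beyond tree
theorems: the fibres of the pencil are smooth projective `n`-folds (`IsSmoothProjectiveFamily.isSmoothProjective`), and on a smooth
projective complex `n`-fold every rational `(p,p)`-class with `p ≤ 1` or `p ≥ n − 1` is a divisor polynomial (the tree's THEOREM
`hodgeClasses_divisorial_of_le_one_or_le_succ` — Moonen–Zarhin 1999, Introduction: `H⁰ = ℂ·1`, `B¹ = D¹`, hard Lefschetz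
`nonempty_hardLefschetzNFold_holds`, `H^{2p} = 0` above the top) and a divisor polynomial is algebraic (§1, Lefschetz `(1,1)`
`lefschetzOneOne_rational_holds` + Voisin II Prop. 9.20 `cupProduct_mem_algebraicClasses_one_right`, on every smooth projective variety —
the fibres are only ISOMORPHIC to abelian varieties, so the tree's `A.X`-forms do not apply verbatim). Hence the regime hypothesis is
CONTRADICTORY off the middle range and `LefAtExceptionalRegimeAt 𝒪 n p` holds there with no datum produced (§2); so

* `LefAtExceptionalRegime 𝒪 ↔ ∀ n p, 2 ≤ p → p + 2 ≤ n → LefAtExceptionalRegimeAt 𝒪 n p` (`lefAtExceptionalRegime_iff_midRange`);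
* for doors with null data, `AdmissibleRepresentativesLefAt 𝒪 ↔` the same middle-range family
  (`admissibleRepresentativesLefAt_iff_midRange_of_hasNullDatum`), and K-SR♭∃ HOLDS degree-wise off the middle range and on every
  pencil of relative dimension `≤ 3` (`admissibleRepresentativesLefAtDeg_of_offMidRange_of_hasNullDatum`,
  `…_of_relDim_le_three_of_hasNullDatum`);
* the two items: `semiregularSheafRepresentativesLefAt_iff_midRange` (19779), `twAt_iff_midRange` (19274, the route decl by `rfl`);
  the BC5 rung is the graded regime at `(6, 3)` (`lefAtExceptionalRegimeSixfoldMiddle_iff_at`, `Iff.rfl`); the FIRST pair of the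
  middle range is `(n, p) = (4, 2)` (`midRange_four_iff`; Weil-type abelian fourfold pencils — no semiregular carrier in print,
  fourfolds being reached by degeneration from split sixfold pencils, Markman Cor. 1.6.1).

What this does NOT do: produce any carrier; touch the middle range (there `W|_s` can be exceptional — `Weil1977_exceptionalHodgeClasses`
— and the null datum fails, `nullDatum_fails_of_exceptional`); use the abelian structure of the fibres or the section (idle in §2).
The registered stub `stub_exceptionalRegimeTw` of `Cruxes/SemiregularSheafRepresentativesTwAt/Lines/birth.lean` may thus be READ (or
re-registered, the LEAD's call) middle-range only; nothing is filed on the skeleton here.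

References: [cite: MoonenZarhin1999LowDim, Introduction (p. 711)] [cite: VoisinHodgeI2002, Thm. 6.25, Rem. 6.27, §7.1.2, Thm. 11.30]
[cite: VoisinHodgeII2003, §9.2.4 Prop. 9.20] [cite: vanGeemen1994HodgeAV, §2.4 and Thm. 4.11] [cite: Bloch1972Semiregularity, Remark (7.5)]
[cite: BuchweitzFlenner2003, §5 Thm. 5.1] [cite: Markman2025SecantWeil, Thm. 1.4.1, Thm. 1.5.1, Cor. 1.6.1].
-/

noncomputable section

open CategoryTheory CategoryTheory.Limits AlgebraicGeometry Topology

namespace Summit.HodgeConjecture.HodgeConjecture.Ring2.SemiregularRepresentatives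

-- the cell's namespace repeats the summit name (`Summit.HodgeConjecture.HodgeConjecture…`), as in every `Ring2*` file
set_option linter.dupNamespace false

open Literature.AlgebraicGeometry Literature.AlgebraicGeometry.Motives
open Literature.AlgebraicGeometry.HodgeTheory
open Literature.AlgebraicTopology.SingularHomology
open Literature.Barriers.HodgeConjecture (divisorClassesSpan divisorMonomials mem_divisorMonomials_zero mem_divisorMonomials_succ)
open Summit.Ventures.HSemireg (ObjClass bfSheafClass)

/-! ## §1 Fibre level: off the middle range every Hodge class of a smooth projective `n`-fold is an ALGEBRAIC LEFSCHETZ class -/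

section Fibre

variable {n : ℕ} {X : SchemeOver ℂ}

/-- **The divisor ring lies in the algebraic classes on EVERY smooth projective complex variety**: `Dᵖ(X) ⊗ ℂ ⊆ Nᵖ H²ᵖ(X(ℂ); ℂ)` —
Lefschetz `(1,1)` for the generators (the tree's THEOREM `lefschetzOneOne_rational_holds`) and «`cl(Z · D) = cl(Z) ∪ cl(D)`» for the
products (the tree's THEOREM `cupProduct_mem_algebraicClasses_one_right`, Voisin II Prop. 9.20 on every smooth projective variety);
`1 ∈ N⁰ H⁰ = H⁰`. No abelian hypothesis (the tree's `AbelianVariety.divisorClassesSpan_le_algebraicClasses` and its `_holds` / `_dim`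
forms are stated for `A.X`, `A : AbelianVariety ℂ`; the fibres `𝒳_s` of a pencil are only ISOMORPHIC to such).
[cite: VoisinHodgeI2002, Thm. 11.30] [cite: VoisinHodgeII2003, §9.2.4 Prop. 9.20] [cite: vanGeemen1994HodgeAV, §2.4] -/
theorem divisorClassesSpan_le_algebraicClasses_of_isSmoothProjective (hX : IsSmoothProjective n X) :
    ∀ p : ℕ, divisorClassesSpan X n p ≤ algebraicClasses X p
  | 0 => by
    rw [show algebraicClasses X 0 = ⊤ from algebraicClasses_zero]
    exact le_top
  | p + 1 => by
    refine Submodule.span_le.2 fun c hc ↦ ?_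
    obtain ⟨a, ha, b, hb, hb', rfl⟩ := mem_divisorMonomials_succ.1 hc
    exact cupProduct_mem_algebraicClasses_one_right hX
      (divisorClassesSpan_le_algebraicClasses_of_isSmoothProjective hX p (Submodule.subset_span ha))
      (lefschetzOneOne_rational_holds hX b hb hb')

/-- **Off the middle range every Hodge class is an algebraic Lefschetz class.** On a smooth projective complex `n`-fold `X`, a rational
`(p,p)`-class `c ∈ H²ᵖ(X(ℂ); ℂ)` with `p ≤ 1` or `p ≥ n − 1` lies in `Dᵖ(X) ⊗ ℂ` — the tree's THEOREM
`hodgeClasses_divisorial_of_le_one_or_le_succ` (Moonen–Zarhin's introductory remark on the real carriers: `H⁰ = ℂ·1`, `B¹ = D¹`,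
hard Lefschetz `L^{n-2} : H² ⥲ H^{2n-2}` and `Lⁿ : H⁰ ⥲ H²ⁿ` over `ℚ` and of bidegree `(j,j)`, `H^{2p} = 0` for `p > n`; via
`nonempty_hardLefschetzNFold_holds`) — hence in `Nᵖ H²ᵖ` by `divisorClassesSpan_le_algebraicClasses_of_isSmoothProjective`. FACT-FREE.
[cite: MoonenZarhin1999LowDim, Introduction (p. 711)] [cite: VoisinHodgeI2002, Thm. 6.25, Rem. 6.27 and Thm. 11.30]
[cite: vanGeemen1994HodgeAV, §2.4] -/
theorem mem_algebraicClasses_and_divisorClassesSpan_of_offMidRange (hX : IsSmoothProjective n X) {p : ℕ} (hp : p ≤ 1 ∨ n ≤ p + 1)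
    (c : complexBetti X (2 * p)) (hc : IsRationalClass c) (hpp : IsOfHodgeType n X (2 * p) p p c) :
    c ∈ algebraicClasses X p ∧ c ∈ divisorClassesSpan X n p :=
  have h := hodgeClasses_divisorial_of_le_one_or_le_succ hX hp c hc hpp
  ⟨divisorClassesSpan_le_algebraicClasses_of_isSmoothProjective hX p h, h⟩

/-- Contrapositive, the form in which regime 2 reads it: on a smooth projective complex `n`-fold a rational `(p,p)`-class that is
NOT an algebraic Lefschetz class has `2 ≤ p ≤ n − 2` (for abelian varieties: the tree's `two_le_and_add_two_le_dim_of_exceptional`).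
[cite: MoonenZarhin1999LowDim, Introduction (p. 711)] [cite: vanGeemen1994HodgeAV, §2.4 and Thm. 4.11] -/
theorem midRange_of_not_algebraic_lefschetz (hX : IsSmoothProjective n X) {p : ℕ} {c : complexBetti X (2 * p)}
    (hc : IsRationalClass c) (hpp : IsOfHodgeType n X (2 * p) p p c)
    (h : ¬ (c ∈ algebraicClasses X p ∧ c ∈ divisorClassesSpan X n p)) : 2 ≤ p ∧ p + 2 ≤ n := by
  by_contra h'
  exact h (mem_algebraicClasses_and_divisorClassesSpan_of_offMidRange hX (by omega) c hc hpp)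

end Fibre

/-! ## §2 Pencil level: regime 2 is VOID off the middle range `2 ≤ p ≤ n − 2`, for every door -/

section Pencil

variable {𝒪 : ObjClass}

/-- **`LefAtExceptionalRegime 𝒪 ↔ ∀ n p, LefAtExceptionalRegimeAt 𝒪 n p`** (the graded predicate is the parent with `n`, `p` fixed;
reorder the binders). [folklore] -/
theorem lefAtExceptionalRegime_iff_forall_at : LefAtExceptionalRegime 𝒪 ↔ ∀ n p : ℕ, LefAtExceptionalRegimeAt 𝒪 n p :=
  ⟨fun h _ p _ _ f hf h𝒳 hirr haff hsm hdim habel he W hW s₀ hs₀ hexc => h f hf h𝒳 hirr haff hsm hdim habel he p W hW s₀ hs₀ hexc,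
    fun h n _ _ f hf h𝒳 hirr haff hsm hdim habel he p W hW s₀ hs₀ hexc => h n p f hf h𝒳 hirr haff hsm hdim habel he W hW s₀ hs₀ hexc⟩

/-- **`AdmissibleRepresentativesLefAt 𝒪 ↔ ∀ n p, AdmissibleRepresentativesLefAtDeg 𝒪 n p`** (K-SR♭∃ degree by degree). [folklore] -/
theorem admissibleRepresentativesLefAt_iff_forall_deg :
    AdmissibleRepresentativesLefAt 𝒪 ↔ ∀ n p : ℕ, AdmissibleRepresentativesLefAtDeg 𝒪 n p :=
  ⟨fun h _ p _ _ f hf h𝒳 hirr haff hsm hdim habel he W hW s₀ hs₀ => h f hf h𝒳 hirr haff hsm hdim habel he p W hW s₀ hs₀,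
    fun h n _ _ f hf h𝒳 hirr haff hsm hdim habel he p W hW s₀ hs₀ => h n p f hf h𝒳 hirr haff hsm hdim habel he W hW s₀ hs₀⟩

/-- **The BC5 rung is the graded regime at `(6, 3)`**: `LefAtExceptionalRegimeSixfoldMiddle 𝒪 ↔ LefAtExceptionalRegimeAt 𝒪 6 3`
(definitionally). [cite: Markman2025SecantWeil, Thm. 1.5.1] -/
theorem lefAtExceptionalRegimeSixfoldMiddle_iff_at : LefAtExceptionalRegimeSixfoldMiddle 𝒪 ↔ LefAtExceptionalRegimeAt 𝒪 6 3 :=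
  Iff.rfl

/-- **K-SR♭∃ at `(n, p)` from the two regimes at `(n, p)`** (regime 1 is taken globally, as landed): classical case split on
«`W` algebraic-Lefschetz on every fibre». [cite: vanGeemen1994HodgeAV, §2.4] -/
theorem admissibleRepresentativesLefAtDeg_of_regimes {n p : ℕ} (h₁ : LefAtLefschetzRegime 𝒪) (h₂ : LefAtExceptionalRegimeAt 𝒪 n p) :
    AdmissibleRepresentativesLefAtDeg 𝒪 n p := by
  intro 𝒳 S f hf h𝒳 hirr haff hsm hdim habel he W hW s₀ hs₀
  by_cases hL : ∀ s : ComplexPoints S,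
      complexBetti.map (fiberι f s) (2 * p) W ∈ algebraicClasses (fiberOver f s) p ∧
      complexBetti.map (fiberι f s) (2 * p) W ∈ divisorClassesSpan (fiberOver f s) n p
  · exact h₁ f hf h𝒳 hirr haff hsm hdim habel he p W hW s₀ hs₀ hL
  · exact h₂ f hf h𝒳 hirr haff hsm hdim habel he W hW s₀ hs₀ hL

/-- K-SR♭∃ at `(n, p)` ⟹ regime 2 at `(n, p)` (drop the regime hypothesis). [folklore] -/
theorem lefAtExceptionalRegimeAt_of_admissibleRepresentativesLefAtDeg {n p : ℕ} (h : AdmissibleRepresentativesLefAtDeg 𝒪 n p) :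
    LefAtExceptionalRegimeAt 𝒪 n p :=
  fun _ _ f hf h𝒳 hirr haff hsm hdim habel he W hW s₀ hs₀ _ => h f hf h𝒳 hirr haff hsm hdim habel he W hW s₀ hs₀

variable (𝒪)

/-- **DEGREE CONFINEMENT — regime 2 is VOID off the middle range, for EVERY door.** For `p ≤ 1` or `p ≥ n − 1` the hypothesis of
`LefAtExceptionalRegimeAt 𝒪 n p` — «`W` is NOT algebraic-Lefschetz on every fibre» — is contradictory: every fibre is a smooth
projective `n`-fold (`IsSmoothProjectiveFamily.isSmoothProjective`), on which a rational `(p,p)`-class in such a degree is an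
algebraic divisor polynomial (`mem_algebraicClasses_and_divisorClassesSpan_of_offMidRange`: Lefschetz `(1,1)`, hard Lefschetz,
`H⁰ = ℂ·1` — tree theorems). So the statement holds with NO datum produced; the door `𝒪`, the abelian structure of the fibres and the
section are not used. [cite: VoisinHodgeI2002, Thm. 6.25 and Thm. 11.30] [cite: vanGeemen1994HodgeAV, §2.4 and Thm. 4.11] -/
theorem lefAtExceptionalRegimeAt_of_offMidRange {n p : ℕ} (hp : p ≤ 1 ∨ n ≤ p + 1) : LefAtExceptionalRegimeAt 𝒪 n p := by
  intro 𝒳 S f hf h𝒳 hirr haff hsm hdim habel he W hW s₀ hs₀ hexc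
  exact (hexc fun s => mem_algebraicClasses_and_divisorClassesSpan_of_offMidRange (hf.isSmoothProjective s) hp _
    (hW s).1 (hW s).2).elim

/-- Relative dimension `≤ 3`: regime 2 is void in EVERY codimension (the middle range `2 ≤ p ≤ n − 2` is empty).
[cite: VoisinHodgeI2002, Thm. 6.25 and Thm. 11.30] -/
theorem lefAtExceptionalRegimeAt_of_relDim_le_three {n : ℕ} (hn : n ≤ 3) (p : ℕ) : LefAtExceptionalRegimeAt 𝒪 n p :=
  lefAtExceptionalRegimeAt_of_offMidRange 𝒪 (by omega)

/-- Codimension `≤ 1` and codimension `≥ n − 1`, spelled out: `p = 0`, `p = 1`, `p = n - 1`, `p = n`, `p > n`.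
[cite: VoisinHodgeI2002, Thm. 6.25 and Thm. 11.30] -/
theorem lefAtExceptionalRegimeAt_zero (n : ℕ) : LefAtExceptionalRegimeAt 𝒪 n 0 :=
  lefAtExceptionalRegimeAt_of_offMidRange 𝒪 (by omega)

/-- `p = 1`: Lefschetz `(1,1)`. [cite: VoisinHodgeI2002, Thm. 11.30] -/
theorem lefAtExceptionalRegimeAt_one (n : ℕ) : LefAtExceptionalRegimeAt 𝒪 n 1 :=
  lefAtExceptionalRegimeAt_of_offMidRange 𝒪 (by omega)

/-- `p = n - 1`: hard Lefschetz `L^{n-2} : H² ⥲ H^{2n-2}`. [cite: VoisinHodgeI2002, Thm. 6.25] -/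
theorem lefAtExceptionalRegimeAt_sub_one (n : ℕ) : LefAtExceptionalRegimeAt 𝒪 n (n - 1) :=
  lefAtExceptionalRegimeAt_of_offMidRange 𝒪 (by omega)

/-- `p = n`: `H²ⁿ = ℂ · [H]ⁿ`. [cite: VoisinHodgeI2002, Thm. 6.25] -/
theorem lefAtExceptionalRegimeAt_self (n : ℕ) : LefAtExceptionalRegimeAt 𝒪 n n :=
  lefAtExceptionalRegimeAt_of_offMidRange 𝒪 (by omega)

/-- `p > n`: `H^{p,p} = 0`. [cite: VoisinHodgeI2002, Rem. 6.27] -/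
theorem lefAtExceptionalRegimeAt_of_lt {n p : ℕ} (hnp : n < p) : LefAtExceptionalRegimeAt 𝒪 n p :=
  lefAtExceptionalRegimeAt_of_offMidRange 𝒪 (by omega)

variable {𝒪}

/-- **`LefAtExceptionalRegime 𝒪` ⟺ its middle-range part**: the exceptional regime of K-SR♭∃ for the door `𝒪` holds iff it holds at
every `(n, p)` with `2 ≤ p ≤ n − 2` — the research content of road b02 lives in relative dimension `n ≥ 4`, codimensions
`2 ≤ p ≤ n − 2`, FIRST PAIR `(n, p) = (4, 2)` (where Weil-type abelian fourfolds carry exceptional `(2,2)`-classes,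
`Weil1977_exceptionalHodgeClasses`, van Geemen Thm. 4.11). [cite: vanGeemen1994HodgeAV, §2.4 and Thm. 4.11]
[cite: VoisinHodgeI2002, Thm. 6.25 and Thm. 11.30] [cite: Bloch1972Semiregularity, Remark (7.5)] -/
theorem lefAtExceptionalRegime_iff_midRange :
    LefAtExceptionalRegime 𝒪 ↔ ∀ n p : ℕ, 2 ≤ p → p + 2 ≤ n → LefAtExceptionalRegimeAt 𝒪 n p := by
  refine ⟨fun h n p _ _ => lefAtExceptionalRegime_iff_forall_at.1 h n p, fun h => lefAtExceptionalRegime_iff_forall_at.2 fun n p => ?_⟩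
  by_cases hmid : 2 ≤ p ∧ p + 2 ≤ n
  · exact h n p hmid.1 hmid.2
  · exact lefAtExceptionalRegimeAt_of_offMidRange 𝒪 (by omega)

/-- **For a door with null data, K-SR♭∃ at `(n, p)` HOLDS off the middle range** (regime 1 free — `lefAtLefschetzRegime_of_hasNullDatum`,
p434003 — and regime 2 void there). [cite: Bloch1972Semiregularity, Remark (7.5)] [cite: VoisinHodgeI2002, Thm. 6.25 and Thm. 11.30] -/
theorem admissibleRepresentativesLefAtDeg_of_offMidRange_of_hasNullDatum (h𝒪 : HasNullDatum 𝒪) {n p : ℕ}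
    (hp : p ≤ 1 ∨ n ≤ p + 1) : AdmissibleRepresentativesLefAtDeg 𝒪 n p :=
  admissibleRepresentativesLefAtDeg_of_regimes (lefAtLefschetzRegime_of_hasNullDatum h𝒪) (lefAtExceptionalRegimeAt_of_offMidRange 𝒪 hp)

/-- **For a door with null data, K-SR♭∃ HOLDS on every pencil of relative dimension `≤ 3`**, in every codimension (curves, surfaces,
threefolds: no exceptional Hodge classes on the fibres). [cite: VoisinHodgeI2002, Thm. 6.25 and Thm. 11.30]
[cite: Bloch1972Semiregularity, Remark (7.5)] -/
theorem admissibleRepresentativesLefAtDeg_of_relDim_le_three_of_hasNullDatum (h𝒪 : HasNullDatum 𝒪) {n : ℕ} (hn : n ≤ 3)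
    (p : ℕ) : AdmissibleRepresentativesLefAtDeg 𝒪 n p :=
  admissibleRepresentativesLefAtDeg_of_offMidRange_of_hasNullDatum h𝒪 (by omega)

/-- **For a door with null data, K-SR♭∃ ⟺ the middle-range exceptional regime**: `AdmissibleRepresentativesLefAt 𝒪` holds iff
`LefAtExceptionalRegimeAt 𝒪 n p` holds for all `2 ≤ p ≤ n − 2` (with `admissibleRepresentativesLefAt_iff_lefAtExceptionalRegime_of_hasNullDatum`,
p436772). [cite: Bloch1972Semiregularity, Remark (7.5)] [cite: vanGeemen1994HodgeAV, §2.4 and Thm. 4.11] -/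
theorem admissibleRepresentativesLefAt_iff_midRange_of_hasNullDatum (h𝒪 : HasNullDatum 𝒪) :
    AdmissibleRepresentativesLefAt 𝒪 ↔ ∀ n p : ℕ, 2 ≤ p → p + 2 ≤ n → LefAtExceptionalRegimeAt 𝒪 n p :=
  (admissibleRepresentativesLefAt_iff_lefAtExceptionalRegime_of_hasNullDatum h𝒪).trans lefAtExceptionalRegime_iff_midRange

end Pencil

/-! ## §3 The two items of road b02, confined to the middle range -/

section Items

/-- **Item 19779 (the aside, sheaf door) ⟺ its middle-range exceptional regime**: `SemiregularSheafRepresentativesLefAt` holds iff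
for every Chern character theory `C` and every `2 ≤ p ≤ n − 2`, `LefAtExceptionalRegimeAt (bfSheafClass C) n p`.
[cite: BuchweitzFlenner2003, §5 Thm. 5.1 and Def. 4.10] [cite: vanGeemen1994HodgeAV, §2.4 and Thm. 4.11] -/
theorem semiregularSheafRepresentativesLefAt_iff_midRange :
    SemiregularSheafRepresentativesLefAt ↔
      ∀ (C : ChernCharacterBetti) (n p : ℕ), 2 ≤ p → p + 2 ≤ n → LefAtExceptionalRegimeAt (bfSheafClass C) n p :=
  forall_congr' fun C => admissibleRepresentativesLefAt_iff_midRange_of_hasNullDatum (hasNullDatum_bfSheafClass C)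

/-- **Item 19274 (the crux, twisted door) ⟺ its middle-range exceptional regime**: the twin statement
`∀ C, AdmissibleRepresentativesLefAt (twistedReflexiveClass C AdmTw)`, `AdmTw := gluableSigmaAdmissible ∨ bfSingleAdmissible` (the
route item `Theses.VHCAbelianSchemesRoad.SemiregularSheafRepresentativesTwAt` by `rfl`), holds iff for every `C` and every
`2 ≤ p ≤ n − 2`, `LefAtExceptionalRegimeAt (twistedReflexiveClass C AdmTw) n p`. In particular the registered stub
`stub_exceptionalRegimeTw` may be read middle-range only, and the BC5 rung `(6, 3)` is one of its instances.
[cite: Bloch1972Semiregularity, Remark (7.5)] [cite: Markman2025SecantWeil, Thm. 1.5.1] [cite: vanGeemen1994HodgeAV, §2.4 and Thm. 4.11] -/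
theorem twAt_iff_midRange :
    (∀ C : ChernCharacterBetti, AdmissibleRepresentativesLefAt (Literature.AlgebraicGeometry.HodgeTheory.twistedReflexiveClass C
      (fun n X₀ I E => Summit.Ventures.HSemireg.gluableSigmaAdmissible n X₀ I E ∨
        Literature.AlgebraicGeometry.HodgeTheory.bfSingleAdmissible n X₀ I E))) ↔
    ∀ (C : ChernCharacterBetti) (n p : ℕ), 2 ≤ p → p + 2 ≤ n →
      LefAtExceptionalRegimeAt (Literature.AlgebraicGeometry.HodgeTheory.twistedReflexiveClass C
        (fun n X₀ I E => Summit.Ventures.HSemireg.gluableSigmaAdmissible n X₀ I E ∨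
          Literature.AlgebraicGeometry.HodgeTheory.bfSingleAdmissible n X₀ I E)) n p :=
  forall_congr' fun C => admissibleRepresentativesLefAt_iff_midRange_of_hasNullDatum
    (hasNullDatum_twistedReflexiveClass C _ fun _ _ _ _ h => Or.inr h)

/-- **The twin crux HOLDS degree-wise off the middle range** (no carrier needed there): for every `C` and every `(n, p)` with `p ≤ 1`
or `p ≥ n − 1`, `AdmissibleRepresentativesLefAtDeg (twistedReflexiveClass C AdmTw) n p`. [cite: Bloch1972Semiregularity, Remark (7.5)]
[cite: VoisinHodgeI2002, Thm. 6.25 and Thm. 11.30] -/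
theorem twAtDeg_of_offMidRange (C : ChernCharacterBetti) {n p : ℕ} (hp : p ≤ 1 ∨ n ≤ p + 1) :
    AdmissibleRepresentativesLefAtDeg (Literature.AlgebraicGeometry.HodgeTheory.twistedReflexiveClass C
      (fun n X₀ I E => Summit.Ventures.HSemireg.gluableSigmaAdmissible n X₀ I E ∨
        Literature.AlgebraicGeometry.HodgeTheory.bfSingleAdmissible n X₀ I E)) n p :=
  admissibleRepresentativesLefAtDeg_of_offMidRange_of_hasNullDatum
    (hasNullDatum_twistedReflexiveClass C _ fun _ _ _ _ h => Or.inr h) hp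

/-- **The first instance**: the middle range is non-empty exactly from relative dimension `4` on, and at `n = 4` it is the single
codimension `p = 2` — so the twin crux, read through `twAt_iff_midRange`, BEGINS with `LefAtExceptionalRegimeAt (twistedReflexiveClass C AdmTw) 4 2`
(Weil-type abelian FOURFOLD pencils, where no semiregular carrier is in print; fourfolds are reached by degeneration from split sixfold
pencils, Markman Cor. 1.6.1). [cite: vanGeemen1994HodgeAV, Thm. 4.11] [cite: Markman2025SecantWeil, Thm. 1.4.1 and Cor. 1.6.1] -/
theorem midRange_four_iff (p : ℕ) : (2 ≤ p ∧ p + 2 ≤ 4) ↔ p = 2 := by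
  omega

/-- No pair `(n, p)` with `n ≤ 3` is in the middle range. [folklore] -/
theorem not_midRange_of_le_three {n p : ℕ} (hn : n ≤ 3) : ¬ (2 ≤ p ∧ p + 2 ≤ n) := by
  omega

end Items

end Summit.HodgeConjecture.HodgeConjecture.Ring2.SemiregularRepresentatives

end
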